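import Literature.AlgebraicGeometry.HodgeTheory.AffineVarietyCoordinates
import Literature.AlgebraicGeometry.Motives.SmoothMorphismSubmersion
import Literature.AlgebraicGeometry.Motives.AbelianVarietyProofs
import Literature.AlgebraicGeometry.FundamentalGroup.RiemannExistenceLineProjection
import Literature.AlgebraicGeometry.FundamentalGroup.RiemannExistenceZariskiLocal
import Mathlib.Algebra.MvPolynomial.Funext
import Literature.Analysis.Complex.OsgoodProofs
import Mathlib.RingTheory.RingHom.StandardSmooth
import Mathlib.RingTheory.RingHom.Etale
import Mathlib.RingTheory.Unramified.Finite
import Mathlib.RingTheory.Localization.Integral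
import Mathlib.AlgebraicGeometry.Morphisms.Etale
import Mathlib.Analysis.Calculus.InverseFunctionTheorem.ContDiff
import Mathlib.Analysis.Polynomial.CauchyBound
import HarnessLib

/-!
# Étale coordinates on a smooth affine complex variety: existence, holomorphy of regular functions,
# generic finiteness

Layer `Literature/AlgebraicGeometry/FundamentalGroup`; algebraic input of the smooth affine case of
Riemann's existence theorem in all dimensions (SGA 1 XII Thm. 5.1, proof, part 2, where the
transcendental construction is run in étale coordinates). For a `ℂ`-scheme `S` smooth of relative
dimension `d` and a complex point `P₀`:

* `exists_ne_zero_isIntegralElem_mul` — **generic finiteness of an étale algebra over a domain**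
  (pure algebra): for `g : R → A` étale with `R`, `A` domains, every `a ∈ A` has a multiple `g(m) a`,
  `m ≠ 0`, INTEGRAL over `R` (the generic fibre `A ⊗ K` is unramified and essentially of finite type
  over `K = Frac R`, hence finite, Mathlib `Algebra.FormallyUnramified.finite_of_free`);
* `exists_etaleCoordinates` — **étale coordinates exist**: `P₀` has an affine open neighbourhood `V`
  with `d` functions `x₁, …, x_d ∈ Γ(V, 𝒪)` defining an ÉTALE morphism `V → 𝔸ᵈ_ℂ` (a standard smooth
  presentation, the tree's `AlgPoints.exists_isStandardSmoothOfRelativeDimension_scalarRingHom`, factors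
  through an étale map from the polynomial ring, Mathlib
  `RingHom.IsStandardSmoothOfRelativeDimension.exists_etale_mvPolynomial`);
* `exists_chart_coordMap` — **regular functions are holomorphic in étale coordinates** (SGA 1 XII
  Prop. 3.1 (iii): `x^an` is a local isomorphism): the coordinate map `x(ℂ) : V(ℂ) → ℂᵈ` of an étale
  `x : V → 𝔸ᵈ` is, near every point, a chart of `V(ℂ)` along whose inverse all regular functions are
  holomorphic (the tree's submersion theorem `surjective_fderiv_chart_map` in the algebraic charts of
  `exists_algebraicChart_holds`, and the holomorphic inverse function theorem);
* `exists_isCompact_preimage_coordMap` — **`x(ℂ)` is proper over a dense Zariski open `{δ ≠ 0}`**: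
  generic finiteness bounds the generators of `Γ(V, 𝒪)` on `x(ℂ)⁻¹(K)`, `K ⊆ {δ ≠ 0}` compact, and the
  closed embedding of `V(ℂ)` by its generators is proper (`HodgeTheory.isProperMap_coordMap`).

Everything is proved; there are no named facts and no new definitions.

## References

* A. Grothendieck, M. Raynaud, *SGA 1*, Exp. I Thm. 7.6, Exp. XII Prop. 3.1 (iii), 3.2 (v),
  Thm. 5.1. [SGA1]
* J.-P. Serre, *Géométrie algébrique et géométrie analytique*, Ann. Inst. Fourier 6 (1956), §2 n°5–6.
  [SerreGAGA1956]

#harness_tags algebraic_geometry.sga1, algebraic_geometry.gaga, complex_geometry.riemann_existence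
-/

noncomputable section

open scoped Topology Polynomial nonZeroDivisors ContDiff
open CategoryTheory AlgebraicGeometry Set Filter Function
open Literature.AlgebraicGeometry.Motives
open Literature.AlgebraicGeometry.Motives.AlgPoints (evalOrZero evalOrZero_of_mem)
open Literature.NumberTheory.Transcendental

universe u

namespace Literature.AlgebraicGeometry.FundamentalGroup

namespace EtaleCoordinates

/-! ### Generic finiteness of an étale algebra over a domain -/

/-- **Generic finiteness of an étale algebra over a domain.** Let `g : R → A` be an étale ring
map between domains. Then every `a ∈ A` has a multiple `g(m)·a` with `m ≠ 0` which is integral over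
`R`. (The generic fibre `A ⊗_R K`, `K = Frac R`, is formally unramified and essentially of finite
type over the field `K`, hence a finite `K`-module; clear denominators.)
[cite: SGA1, Exp. I Thm. 7.6 and Exp. XII Prop. 3.2 (v)] -/
theorem exists_ne_zero_isIntegralElem_mul {R A : Type*} [CommRing R] [IsDomain R] [CommRing A] [IsDomain A]
    (g : R →+* A) (hg : g.Etale) (a : A) : ∃ m : R, m ≠ 0 ∧ g.IsIntegralElem (g m * a) := by
  classical
  letI := g.toAlgebra
  haveI : Algebra.Etale R A := hg
  -- if `g` is not injective, a non-zero element of the kernel does it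
  by_cases hinj : Function.Injective g
  swap
  · obtain ⟨m, hm, hm0⟩ : ∃ m, g m = 0 ∧ m ≠ 0 := by
      by_contra h
      push Not at h
      exact hinj ((injective_iff_map_eq_zero g).2 fun m hm ↦ h m hm)
    exact ⟨m, hm0, ⟨Polynomial.X, Polynomial.monic_X, by simp [hm]⟩⟩
  -- the generic fibre `A_K = A[(g R⁰)⁻¹]` over `K = Frac R`
  set M : Submonoid A := Algebra.algebraMapSubmonoid A R⁰ with hM
  have hMle : M ≤ A⁰ := by
    rintro _ ⟨m, hm, rfl⟩
    exact mem_nonZeroDivisors_of_ne_zero (by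
      rw [RingHom.algebraMap_toAlgebra]
      exact fun h ↦ nonZeroDivisors.ne_zero hm (hinj (by rw [h, map_zero])))
  haveI : Algebra.FormallyUnramified A (Localization M) := Algebra.FormallyUnramified.of_isLocalization M
  haveI : Algebra.FormallyUnramified R (Localization M) := Algebra.FormallyUnramified.comp R A (Localization M)
  haveI : Algebra.FormallyUnramified (FractionRing R) (Localization M) :=
    Algebra.FormallyUnramified.of_restrictScalars R _ _
  haveI : Algebra.EssFiniteType R (Localization M) := inferInstance
  haveI : Algebra.EssFiniteType (FractionRing R) (Localization M) := Algebra.EssFiniteType.of_comp R _ _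
  haveI : Module.Finite (FractionRing R) (Localization M) := Algebra.FormallyUnramified.finite_of_free _ _
  -- `a`, read in `A_K`, is integral over `K`; clear denominators
  have hint : IsIntegral (FractionRing R) (algebraMap A (Localization M) a) := Algebra.IsIntegral.isIntegral _
  obtain ⟨⟨m, hm⟩, hma⟩ := IsIntegral.exists_multiple_integral_of_isLocalization R⁰ (algebraMap A (Localization M) a) hint
  refine ⟨m, nonZeroDivisors.ne_zero hm, ?_⟩
  -- pull the integrality back along the injection `A → A_K`
  have hinjA : Function.Injective (algebraMap A (Localization M)) := IsLocalization.injective _ hMle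
  have heq : (⟨m, hm⟩ : R⁰) • algebraMap A (Localization M) a = algebraMap A (Localization M) (g m * a) := by
    rw [Submonoid.smul_def, Algebra.smul_def, map_mul, IsScalarTower.algebraMap_apply R A (Localization M),
      RingHom.algebraMap_toAlgebra]
  rw [heq] at hma
  have := (isIntegral_algHom_iff (IsScalarTower.toAlgHom R A (Localization M)) hinjA).1 hma
  exact this

/-! ### Scalars: the structure maps of `𝔸ᵈ_ℂ` and of an open subscheme -/

open LineProjection HodgeTheory.AffineCoordinates

/-- Under `Γ(𝔸ᵈ_ℂ, ⊤) ≅ ℂ[x₁, …, x_d]` the scalars go to the constants. [folklore] -/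
theorem affineSpaceGlobalSectionsIso_hom_structureMap (d : ℕ) (c : ℂ) :
    (affineSpaceGlobalSectionsIso (Fin d) (.of ℂ)).hom (structureMap (affineSpaceOver (Fin d) ℂ) c) =
      MvPolynomial.C c := by
  apply MvPolynomial.funext
  intro w
  rw [MvPolynomial.eval_C, ← MvPolynomial.coe_aeval_eq_eval]
  have h1 := AlgPoints.eval_top_affinePoint (k := ℂ) (L := ℂ) w (structureMap (affineSpaceOver (Fin d) ℂ) c)
  exact h1.symm.trans (eval_structureMap (affineSpaceOver (Fin d) ℂ) (AlgPoints.affinePoint ℂ w) c)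

/-- The inverse form: constants go to scalars. [folklore] -/
theorem affineSpaceGlobalSectionsIso_inv_C (d : ℕ) (c : ℂ) :
    (affineSpaceGlobalSectionsIso (Fin d) (.of ℂ)).inv (MvPolynomial.C c) =
      structureMap (affineSpaceOver (Fin d) ℂ) c := by
  rw [← affineSpaceGlobalSectionsIso_hom_structureMap, Iso.hom_inv_id_apply]

/-- The inverse form for coordinates: `xᵢ ↦ coord i`. [folklore] -/
theorem affineSpaceGlobalSectionsIso_inv_X (d : ℕ) (i : Fin d) :
    (affineSpaceGlobalSectionsIso (Fin d) (.of ℂ)).inv (MvPolynomial.X i) = AffineSpace.coord (Spec (.of ℂ)) i := by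
  rw [← affineSpaceGlobalSectionsIso_hom_coord, Iso.hom_inv_id_apply]

/-- **The scalars of an open subscheme**: transported along `Γ(V, ⊤) ≅ Γ(S, V)`, the scalar map
`ℂ → Γ(S, V)` is the structure map of the open subscheme `V`. [folklore] -/
theorem topIso_inv_scalarRingHom (S : SchemeOver ℂ) (V : S.left.Opens) (c : ℂ) :
    V.topIso.inv (SchemeOver.scalarRingHom S V c) = structureMap (openSubschemeOver S V) c := by
  rw [SchemeOver.scalarRingHom_apply, structureMap]
  simp only [RingHom.coe_comp, comp_apply]
  change V.topIso.inv (S.hom.appLE ⊤ V le_top _) = (V.ι ≫ S.hom).appLE ⊤ ⊤ le_top _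
  have h2 : (⊤ : V.toScheme.Opens) ≤ V.ι ⁻¹ᵁ V := by rw [Scheme.Opens.ι_preimage_self]
  rw [← Scheme.Hom.appLE_comp_appLE V.ι S.hom ⊤ V ⊤ le_top h2, CategoryTheory.comp_apply,
    Scheme.Opens.ι_appLE, Scheme.Opens.topIso_inv]
  congr 2

/-- A morphism over `ℂ` pulls scalars back to scalars. [folklore] -/
theorem appTop_structureMap {X Y : SchemeOver ℂ} (f : X ⟶ Y) (c : ℂ) :
    f.left.appTop (structureMap Y c) = structureMap X c := by
  rw [structureMap_eq_appTop, structureMap_eq_appTop]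
  simp only [RingHom.coe_comp, comp_apply]
  change (Y.hom.appTop ≫ f.left.appTop) _ = _
  rw [← Scheme.Hom.comp_appTop, Over.w f]

/-! ### Existence of étale coordinates -/

/-- **Étale coordinates at a point of a smooth `ℂ`-scheme** (SGA 1 II 1.1 / Exp. I Thm. 7.6 form
of smoothness): a complex point `P₀` of a `ℂ`-scheme smooth of relative dimension `d` has an affine
open neighbourhood `V` with `x₁, …, x_d ∈ Γ(V, 𝒪)` whose morphism `V → 𝔸ᵈ_ℂ` is étale.
[cite: SGA1, Exp. II Cor. 4.9–4.10 and Exp. I Thm. 7.6] -/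
theorem exists_etaleCoordinates (S : SchemeOver ℂ) (d : ℕ) [SmoothOfRelativeDimension d S.hom]
    (P₀ : ComplexPoints S) :
    ∃ (V : S.left.Opens) (_ : IsAffineOpen V), P₀.pt ∈ V ∧
      ∃ x : Fin d → Γ((openSubschemeOver S V).left, ⊤), Etale (coordHom (openSubschemeOver S V) x).left := by
  obtain ⟨V, hV, hPV, hsm⟩ := AlgPoints.exists_isStandardSmoothOfRelativeDimension_scalarRingHom d P₀
  obtain ⟨g, hgC, hget⟩ := RingHom.IsStandardSmoothOfRelativeDimension.exists_etale_mvPolynomial hsm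
  refine ⟨V, hV, hPV, fun i ↦ V.topIso.inv (g (MvPolynomial.X i)), ?_⟩
  haveI : IsAffine (openSubschemeOver S V).left := hV
  haveI : IsAffine (affineSpaceOver (Fin d) ℂ).left := inferInstanceAs (IsAffine 𝔸(Fin d; Spec (.of ℂ)))
  rw [coordHom_left, HasRingHomProperty.iff_of_isAffine (P := @Etale)]
  -- the map on global sections is `Γ(𝔸ᵈ, ⊤) ≅ ℂ[x] —g→ Γ(S, V) ≅ Γ(V, ⊤)`
  have key : (affineSpaceGlobalSectionsIso (Fin d) (.of ℂ)).inv ≫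
      (AffineSpace.homOfVector (openSubschemeOver S V).hom fun i ↦ V.topIso.inv (g (MvPolynomial.X i))).appTop =
      CommRingCat.ofHom g ≫ V.topIso.inv := by
    apply CommRingCat.hom_ext
    refine MvPolynomial.ringHom_ext (fun c ↦ ?_) (fun i ↦ ?_)
    · change (AffineSpace.homOfVector (openSubschemeOver S V).hom fun i ↦ V.topIso.inv (g (MvPolynomial.X i))).appTop
          ((affineSpaceGlobalSectionsIso (Fin d) (.of ℂ)).inv (MvPolynomial.C c)) = V.topIso.inv (g (MvPolynomial.C c))
      rw [affineSpaceGlobalSectionsIso_inv_C, ← RingHom.comp_apply g MvPolynomial.C c, hgC,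
        topIso_inv_scalarRingHom]
      exact appTop_structureMap (coordHom (openSubschemeOver S V) fun i ↦ V.topIso.inv (g (MvPolynomial.X i))) c
    · change (AffineSpace.homOfVector (openSubschemeOver S V).hom fun i ↦ V.topIso.inv (g (MvPolynomial.X i))).appTop
          ((affineSpaceGlobalSectionsIso (Fin d) (.of ℂ)).inv (MvPolynomial.X i)) = V.topIso.inv (g (MvPolynomial.X i))
      rw [affineSpaceGlobalSectionsIso_inv_X, AffineSpace.homOfVector_appTop_coord]
  have key' := (Iso.inv_comp_eq _).1 key
  have h3 : ((affineSpaceGlobalSectionsIso (Fin d) (.of ℂ)).hom ≫ (CommRingCat.ofHom g ≫ V.topIso.inv)).hom.Etale := by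
    rw [CommRingCat.hom_comp, RingHom.Etale.respectsIso.cancel_left_isIso, CommRingCat.hom_comp,
      RingHom.Etale.respectsIso.cancel_right_isIso, CommRingCat.hom_ofHom]
    exact hget
  exact key' ▸ h3

/-! ### Regular functions are holomorphic in étale coordinates -/

/-- Replacing the forward map of a partial homeomorphism by a function agreeing with it on the
source. [folklore] -/
def _root_.OpenPartialHomeomorph.copyFun {X Y : Type*} [TopologicalSpace X] [TopologicalSpace Y]
    (e : OpenPartialHomeomorph X Y) (f : X → Y) (hf : Continuous f) (h : EqOn f e e.source) :
    OpenPartialHomeomorph X Y where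
  toFun := f
  invFun := e.symm
  source := e.source
  target := e.target
  map_source' := fun x hx ↦ by rw [h hx]; exact e.map_source hx
  map_target' := fun y hy ↦ e.map_target hy
  left_inv' := fun x hx ↦ by rw [h hx]; exact e.left_inv hx
  right_inv' := fun y hy ↦ by rw [h (e.map_target hy)]; exact e.right_inv hy
  open_source := e.open_source
  open_target := e.open_target
  continuousOn_toFun := hf.continuousOn
  continuousOn_invFun := e.continuousOn_symm

/-- The forward map of `copyFun`. [folklore] -/
@[simp] theorem _root_.OpenPartialHomeomorph.copyFun_coe {X Y : Type*} [TopologicalSpace X] [TopologicalSpace Y]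
    (e : OpenPartialHomeomorph X Y) (f : X → Y) (hf : Continuous f) (h : EqOn f e e.source) :
    ⇑(e.copyFun f hf h) = f := rfl

/-- The inverse of `copyFun`. [folklore] -/
@[simp] theorem _root_.OpenPartialHomeomorph.copyFun_symm_coe {X Y : Type*} [TopologicalSpace X] [TopologicalSpace Y]
    (e : OpenPartialHomeomorph X Y) (f : X → Y) (hf : Continuous f) (h : EqOn f e e.source) :
    ⇑(e.copyFun f hf h).symm = e.symm := rfl

/-- The source of `copyFun`. [folklore] -/
@[simp] theorem _root_.OpenPartialHomeomorph.copyFun_source {X Y : Type*} [TopologicalSpace X] [TopologicalSpace Y]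
    (e : OpenPartialHomeomorph X Y) (f : X → Y) (hf : Continuous f) (h : EqOn f e e.source) :
    (e.copyFun f hf h).source = e.source := rfl

/-- The target of `copyFun`. [folklore] -/
@[simp] theorem _root_.OpenPartialHomeomorph.copyFun_target {X Y : Type*} [TopologicalSpace X] [TopologicalSpace Y]
    (e : OpenPartialHomeomorph X Y) (f : X → Y) (hf : Continuous f) (h : EqOn f e e.source) :
    (e.copyFun f hf h).target = e.target := rfl

/-- The regular functions on `𝔸ᵈ_ℂ` are `C^ω` in the tautological chart `𝔸ᵈ(ℂ) = ℂᵈ` (the tree's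
`ComplexPoints.differentiableOn_evalOrZero_affinePoint` and Osgood's lemma). [cite: SerreGAGA1956, §2 n°5 Lemme 1 c)] -/
theorem contDiffOn_evalOrZero_affineChart (d : ℕ) (V : (affineSpaceOver (Fin d) ℂ).left.affineOpens)
    (s : Γ((affineSpaceOver (Fin d) ℂ).left, ↑V)) :
    ContDiffOn ℂ ω (evalOrZero ↑V s ∘ ((ComplexPoints.affineHomeomorph d).symm.toOpenPartialHomeomorph).symm)
      (((ComplexPoints.affineHomeomorph d).symm.toOpenPartialHomeomorph).target ∩
        ((ComplexPoints.affineHomeomorph d).symm.toOpenPartialHomeomorph).symm ⁻¹'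
          {Q | Q.pt ∈ (↑V : (affineSpaceOver (Fin d) ℂ).left.Opens)}) := by
  have h1 := ComplexPoints.differentiableOn_evalOrZero_affinePoint d V.1 s
  have hopen := ComplexPoints.isOpen_setOf_pt_affinePoint_mem d V.1
  have h2 : ContDiffOn ℂ ω (fun w ↦ evalOrZero (↑V : (affineSpaceOver (Fin d) ℂ).left.Opens) s (AlgPoints.affinePoint ℂ w))
      {w : Fin d → ℂ | (AlgPoints.affinePoint ℂ w).pt ∈ (↑V : (affineSpaceOver (Fin d) ℂ).left.Opens)} :=
    (Literature.Analysis.Complex.SCV.analyticOnNhd_of_differentiableOn h1 hopen).contDiffOn_of_completeSpace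
  have hset : ((ComplexPoints.affineHomeomorph d).symm.toOpenPartialHomeomorph).target ∩
        ((ComplexPoints.affineHomeomorph d).symm.toOpenPartialHomeomorph).symm ⁻¹'
          {Q | Q.pt ∈ (↑V : (affineSpaceOver (Fin d) ℂ).left.Opens)} =
      {w : Fin d → ℂ | (AlgPoints.affinePoint ℂ w).pt ∈ (↑V : (affineSpaceOver (Fin d) ℂ).left.Opens)} := by
    ext w
    simp [ComplexPoints.coe_affineHomeomorph]
  rw [hset]
  exact h2

variable (S : SchemeOver ℂ) (d : ℕ) [LocallyOfFiniteType S.hom] [SmoothOfRelativeDimension d S.hom] [IsAffine S.left]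
  (x : Fin d → Γ(S.left, ⊤)) [Smooth (coordHom S x).left]

/-- **Regular functions are holomorphic in étale coordinates** (SGA 1 XII Prop. 3.1 (iii)–(iv):
`x^an` is a local isomorphism). For `S` affine, smooth of relative dimension `d` over `ℂ`, and
`x₁, …, x_d ∈ Γ(S, 𝒪_S)` with `x : S → 𝔸ᵈ_ℂ` smooth (i.e. étale), every complex point lies in the
source of a chart `e` of `S(ℂ)` with `⇑e = x(ℂ)` along whose inverse every regular function is
holomorphic. [cite: SGA1, Exp. XII Prop. 3.1 (iii)] [cite: SerreGAGA1956, §2 n°6 Cor. 2] -/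
theorem exists_chart_coordMap (P : ComplexPoints S) :
    ∃ e : OpenPartialHomeomorph (ComplexPoints S) (Fin d → ℂ), P ∈ e.source ∧ ⇑e = coordMap S x ∧
      ∀ w : Γ(S.left, ⊤), DifferentiableOn ℂ ((fun Q : ComplexPoints S ↦ Q.eval ⊤ trivial w) ∘ e.symm) e.target := by
  classical
  -- the algebraic chart at `P`
  set aX := ComplexPoints.algebraicChart S d P with haX
  obtain ⟨algX, holX⟩ := ComplexPoints.algebraicChart_spec S d P
  have hP : P ∈ aX.source := ComplexPoints.mem_algebraicChart_source S d P
  -- the tautological chart of `𝔸ᵈ(ℂ)`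
  set eY : OpenPartialHomeomorph (ComplexPoints (affineSpaceOver (Fin d) ℂ)) (Fin d → ℂ) :=
    (ComplexPoints.affineHomeomorph d).symm.toOpenPartialHomeomorph with heY
  have heYsrc : eY.source = univ := rfl
  have hQ : AlgPoints.map (coordHom S x) P ∈ eY.source := by rw [heYsrc]; exact mem_univ _
  haveI : IsAffine (affineSpaceOver (Fin d) ℂ).left := inferInstanceAs (IsAffine 𝔸(Fin d; Spec (.of ℂ)))
  set V₁ : (affineSpaceOver (Fin d) ℂ).left.affineOpens := ⟨⊤, isAffineOpen_top _⟩ with hV₁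
  have hsrcY : eY.source ⊆ {Q | Q.pt ∈ (↑V₁ : (affineSpaceOver (Fin d) ℂ).left.Opens)} := fun _ _ ↦ trivial
  have hu : ∀ Q ∈ eY.source, ∀ j, eY Q j = evalOrZero (↑V₁ : (affineSpaceOver (Fin d) ℂ).left.Opens)
      (AffineSpace.coord (Spec (.of ℂ)) j) Q := fun Q _ j ↦ AlgPoints.affineCoords_apply Q j
  -- local coordinates at `P`
  obtain ⟨U, hPU, hle, t, htspan⟩ :=
    exists_localCoordinates_le d P ((coordHom S x).left ⁻¹ᵁ ↑V₁) (show P.pt ∈ (coordHom S x).left ⁻¹ᵁ ↑V₁ from trivial)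
  obtain ⟨hGd, hGsurj⟩ := surjective_fderiv_chart_map (coordHom S x) aX hP holX algX eY hQ
    (contDiffOn_evalOrZero_affineChart d) V₁ (AffineSpace.coord (Spec (.of ℂ))) hsrcY hu U hPU hle t htspan
  -- the chart expression is `G = x(ℂ) ∘ aX⁻¹`
  have hGeq : eY ∘ AlgPoints.map (coordHom S x) ∘ aX.symm = coordMap S x ∘ aX.symm := by
    funext w
    simp only [Function.comp_apply, heY, Homeomorph.toOpenPartialHomeomorph_apply, ComplexPoints.coe_affineHomeomorph_symm,
      affineCoords_map_coordHom]
  rw [hGeq] at hGd hGsurj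
  set G : (Fin d → ℂ) → (Fin d → ℂ) := coordMap S x ∘ aX.symm with hGdef
  -- `G` is `C^ω` on `aX.target`
  have hGω : ContDiffOn ℂ ω G aX.target := by
    rw [contDiffOn_pi]
    intro i
    have h1 := holX ⟨⊤, isAffineOpen_top _⟩ (x i)
    have hset : aX.target ∩ aX.symm ⁻¹' {Q : ComplexPoints S | Q.pt ∈ ((⟨⊤, isAffineOpen_top _⟩ : S.left.affineOpens) : S.left.Opens)} =
        aX.target := by
      ext w; simp
    rw [hset] at h1
    refine h1.congr fun w _ ↦ ?_
    simp only [Function.comp_apply, hGdef, coordMap_apply]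
    exact (evalOrZero_of_mem (x i) trivial).symm
  -- the derivative of `G` at `aX P` is bijective: inverse function theorem
  set G' : (Fin d → ℂ) →L[ℂ] (Fin d → ℂ) := fderiv ℂ G (aX P) with hG'
  have hbij : Function.Bijective G' := ⟨LinearMap.injective_iff_surjective.2 hGsurj, hGsurj⟩
  set Le : (Fin d → ℂ) ≃L[ℂ] (Fin d → ℂ) :=
    (LinearEquiv.ofBijective (G' : (Fin d → ℂ) →ₗ[ℂ] (Fin d → ℂ)) hbij).toContinuousLinearEquiv with hLe
  have hLeG' : (Le : (Fin d → ℂ) →L[ℂ] (Fin d → ℂ)) = G' := by ext v; rfl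
  have hPt : aX P ∈ aX.target := aX.map_source hP
  have hGat : ContDiffAt ℂ ω G (aX P) := hGω.contDiffAt (aX.open_target.mem_nhds hPt)
  have hGderiv : HasFDerivAt G (Le : (Fin d → ℂ) →L[ℂ] (Fin d → ℂ)) (aX P) := by
    rw [hLeG']; exact hGd.hasFDerivAt
  have hω0 : (ω : ℕ∞ω) ≠ 0 := by simp
  set φ := hGat.toOpenPartialHomeomorph G hGderiv hω0 with hφ
  have hφcoe : (φ : (Fin d → ℂ) → (Fin d → ℂ)) = G := hGat.toOpenPartialHomeomorph_coe hGderiv hω0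
  have hφsrc : aX P ∈ φ.source := hGat.mem_toOpenPartialHomeomorph_source hGderiv hω0
  have hφsymm : ContDiffAt ℂ ω φ.symm (G (aX P)) := hGat.to_localInverse hGderiv hω0
  -- a neighbourhood `N` of `x(P)` on which `φ⁻¹` is holomorphic
  obtain ⟨N, hNsub, hNopen, hGPN⟩ := _root_.eventually_nhds_iff.1 (hφsymm.eventually (by simp))
  have hNdiff : DifferentiableOn ℂ φ.symm N := fun z hz ↦ ((hNsub z hz).differentiableAt (by simp)).differentiableWithinAt
  -- the chart: `aX` then `φ`, target cut down to `N`, forward map replaced by `x(ℂ)`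
  set e₀ := aX.trans φ with he₀
  set e₁ := (e₀.symm.restrOpen N hNopen).symm with he₁
  have he₁coe : ∀ Q, e₁ Q = G (aX Q) := fun Q ↦ by simp [he₁, he₀, hφcoe]
  have he₁src_eq : e₁.source = e₀.source ∩ e₀ ⁻¹' N := rfl
  have he₁tgt_eq : e₁.target = e₀.target ∩ N := rfl
  have he₁symm : ∀ z, e₁.symm z = aX.symm (φ.symm z) := fun z ↦ rfl
  have he₀src : e₀.source = aX.source ∩ aX ⁻¹' φ.source := OpenPartialHomeomorph.trans_source _ _
  have he₀tgt : e₀.target = φ.target ∩ φ.symm ⁻¹' aX.target := OpenPartialHomeomorph.trans_target _ _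
  have he₁src : e₁.source ⊆ aX.source := fun Q hQ ↦ by
    rw [he₁src_eq, he₀src] at hQ
    exact hQ.1.1
  -- replace the forward map by `x(ℂ)` (they agree on the source)
  have heqOn : EqOn (coordMap S x) e₁ e₁.source := fun Q hQ ↦ by
    rw [he₁coe]
    show coordMap S x Q = coordMap S x (aX.symm (aX Q))
    rw [aX.left_inv (he₁src hQ)]
  set e := e₁.copyFun (coordMap S x) (continuous_coordMap S x) heqOn with he
  refine ⟨e, ?_, rfl, fun w ↦ ?_⟩
  · -- `P ∈ e.source`
    show P ∈ e₁.source
    rw [he₁src_eq, he₀src]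
    refine ⟨⟨hP, hφsrc⟩, ?_⟩
    show φ (aX P) ∈ N
    rw [hφcoe]
    exact hGPN
  · -- holomorphy of `w ∘ e⁻¹ = (w ∘ aX⁻¹) ∘ φ⁻¹` on `e.target ⊆ N`
    have hw := holX ⟨⊤, isAffineOpen_top _⟩ w
    have hset : aX.target ∩ aX.symm ⁻¹' {Q : ComplexPoints S | Q.pt ∈ ((⟨⊤, isAffineOpen_top _⟩ : S.left.affineOpens) : S.left.Opens)} =
        aX.target := by
      ext z; simp
    rw [hset] at hw
    have hw' : DifferentiableOn ℂ ((fun Q : ComplexPoints S ↦ Q.eval ⊤ trivial w) ∘ aX.symm) aX.target := by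
      refine (hw.differentiableOn (by simp)).congr fun z _ ↦ ?_
      simp only [Function.comp_apply]
      exact (evalOrZero_of_mem w trivial).symm
    show DifferentiableOn ℂ ((fun Q : ComplexPoints S ↦ Q.eval ⊤ trivial w) ∘ e₁.symm) e₁.target
    have hcomp : (fun Q : ComplexPoints S ↦ Q.eval ⊤ trivial w) ∘ e₁.symm =
        ((fun Q : ComplexPoints S ↦ Q.eval ⊤ trivial w) ∘ aX.symm) ∘ φ.symm := by
      funext z; simp only [Function.comp_apply, he₁symm]
    rw [hcomp, he₁tgt_eq, he₀tgt]
    refine hw'.comp (hNdiff.mono inter_subset_right) ?_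
    rintro z ⟨⟨-, hz⟩, -⟩
    exact hz

/-! ### Generic finiteness: `x(ℂ)` is proper over a dense Zariski open -/

omit [LocallyOfFiniteType S.hom] [SmoothOfRelativeDimension d S.hom] [IsAffine S.left] [Smooth (coordHom S x).left] in
/-- The ring map `ℂ[X₁, …, X_d] → Γ(S, 𝒪_S)`, `Xᵢ ↦ xᵢ`, evaluated at a complex point is evaluation
of polynomials at `x(P)`. [folklore] -/
theorem evalRingHom_comp_eval₂Hom (P : ComplexPoints S) :
    (P.evalRingHom ⊤ trivial).comp (MvPolynomial.eval₂Hom (structureMap S) x) = MvPolynomial.eval (coordMap S x P) := by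
  refine MvPolynomial.ringHom_ext (fun c ↦ ?_) (fun i ↦ ?_)
  · rw [RingHom.comp_apply, MvPolynomial.eval₂Hom_C, MvPolynomial.eval_C, AlgPoints.evalRingHom_apply, eval_structureMap]
  · rw [RingHom.comp_apply, MvPolynomial.eval₂Hom_X', MvPolynomial.eval_X, AlgPoints.evalRingHom_apply, coordMap_apply]

omit [LocallyOfFiniteType S.hom] [SmoothOfRelativeDimension d S.hom] [Smooth (coordHom S x).left] in
/-- For `x : S → 𝔸ᵈ_ℂ` étale (`S` affine), the ring map `ℂ[X] → Γ(S, 𝒪_S)`, `Xᵢ ↦ xᵢ`, is étale.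
[cite: SGA1, Exp. I §4 (étale morphisms of affine schemes)] -/
theorem etale_eval₂Hom [Etale (coordHom S x).left] : (MvPolynomial.eval₂Hom (structureMap S) x).Etale := by
  haveI : IsAffine (affineSpaceOver (Fin d) ℂ).left := inferInstanceAs (IsAffine 𝔸(Fin d; Spec (.of ℂ)))
  have h1 : ((coordHom S x).left.appTop).hom.Etale := (HasRingHomProperty.iff_of_isAffine (P := @Etale)).1 ‹_›
  have key : (affineSpaceGlobalSectionsIso (Fin d) (.of ℂ)).inv ≫ (coordHom S x).left.appTop =
      CommRingCat.ofHom (MvPolynomial.eval₂Hom (structureMap S) x) := by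
    apply CommRingCat.hom_ext
    refine MvPolynomial.ringHom_ext (fun c ↦ ?_) (fun i ↦ ?_)
    · change (coordHom S x).left.appTop ((affineSpaceGlobalSectionsIso (Fin d) (.of ℂ)).inv (MvPolynomial.C c)) =
        MvPolynomial.eval₂Hom (structureMap S) x (MvPolynomial.C c)
      rw [affineSpaceGlobalSectionsIso_inv_C, MvPolynomial.eval₂Hom_C]
      exact appTop_structureMap (coordHom S x) c
    · change (AffineSpace.homOfVector S.hom x).appTop ((affineSpaceGlobalSectionsIso (Fin d) (.of ℂ)).inv (MvPolynomial.X i)) =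
        MvPolynomial.eval₂Hom (structureMap S) x (MvPolynomial.X i)
      rw [affineSpaceGlobalSectionsIso_inv_X, MvPolynomial.eval₂Hom_X', AffineSpace.homOfVector_appTop_coord]
  have h2 : ((affineSpaceGlobalSectionsIso (Fin d) (.of ℂ)).inv ≫ (coordHom S x).left.appTop).hom.Etale := by
    rw [CommRingCat.hom_comp, RingHom.Etale.respectsIso.cancel_left_isIso]
    exact h1
  rw [key, CommRingCat.hom_ofHom] at h2
  exact h2

omit [SmoothOfRelativeDimension d S.hom] [Smooth (coordHom S x).left] in
/-- **`x(ℂ)` is proper over a dense Zariski open** (SGA 1 XII Prop. 3.2 (v) over the finite locus):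
for `x : S → 𝔸ᵈ_ℂ` étale with `S` affine and integral, there is a polynomial `δ ≠ 0` such that
`x(ℂ)⁻¹(K)` is compact for every compact `K ⊆ {δ ≠ 0}` (generic finiteness bounds the generators of
`Γ(S, 𝒪_S)` there, and the embedding of `S(ℂ)` by its generators is proper).
[cite: SGA1, Exp. XII Prop. 3.2 (v) and Thm. 5.1 (proof, part 2)] -/
theorem exists_isCompact_preimage_coordMap [IsIntegral S.left] [Etale (coordHom S x).left] :
    ∃ δ : MvPolynomial (Fin d) ℂ, δ ≠ 0 ∧ ∀ K ⊆ {w : Fin d → ℂ | MvPolynomial.eval w δ ≠ 0},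
      IsCompact K → IsCompact (coordMap S x ⁻¹' K) := by
  classical
  set g := MvPolynomial.eval₂Hom (structureMap S) x with hg
  have hget : g.Etale := etale_eval₂Hom S d x
  -- generators and their integral multiples
  obtain ⟨M, h, hh⟩ := exists_isClosedImmersion_homOfVector S
  have hint : ∀ j : Fin M, ∃ m : MvPolynomial (Fin d) ℂ, m ≠ 0 ∧ g.IsIntegralElem (g m * h j) := fun j ↦
    exists_ne_zero_isIntegralElem_mul g hget (h j)
  choose m hm0 hmint using hint
  choose p hpmonic hproot using hmint
  refine ⟨∏ j, m j, Finset.prod_ne_zero_iff.2 fun j _ ↦ hm0 j, fun K hK hKc ↦ ?_⟩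
  -- on `K` the `m_j` do not vanish
  have hmK : ∀ j, ∀ w ∈ K, MvPolynomial.eval w (m j) ≠ 0 := fun j w hw h0 ↦ hK hw (by
    show MvPolynomial.eval w (∏ j, m j) = 0
    rw [map_prod]; exact Finset.prod_eq_zero (Finset.mem_univ j) h0)
  -- bounds on `K`: the inverse of `m_j` and the coefficients of `p_j`
  have hBinv : ∀ j, ∃ B, ∀ w ∈ K, ‖(MvPolynomial.eval w (m j))⁻¹‖ ≤ B := fun j ↦
    hKc.exists_bound_of_continuousOn (((MvPolynomial.continuous_eval _).continuousOn).inv₀ (hmK j))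
  choose Binv hBinv using hBinv
  have hBcoef : ∀ j, ∃ B, ∀ w ∈ K, (∑ i ∈ Finset.range (p j).natDegree, ‖MvPolynomial.eval w ((p j).coeff i)‖) ≤ B := by
    intro j
    obtain ⟨B, hB⟩ := hKc.exists_bound_of_continuousOn
      (f := fun w ↦ ∑ i ∈ Finset.range (p j).natDegree, ‖MvPolynomial.eval w ((p j).coeff i)‖)
      (continuous_finsetSum _ fun i _ ↦ (MvPolynomial.continuous_eval _).norm).continuousOn
    refine ⟨B, fun w hw ↦ ?_⟩
    have := hB w hw
    rwa [Real.norm_of_nonneg (Finset.sum_nonneg fun _ _ ↦ norm_nonneg _)] at this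
  choose Bcoef hBcoef using hBcoef
  -- the bound on the generators over `K`
  have hbound : ∀ P : ComplexPoints S, coordMap S x P ∈ K → ∀ j, ‖P.eval ⊤ trivial (h j)‖ ≤ Binv j * (1 + Bcoef j) := by
    intro P hP j
    set w := coordMap S x P with hw
    -- `m_j(w) h_j(P)` is a root of the monic polynomial `p_j(w)`
    set q : ℂ[X] := (p j).map (MvPolynomial.eval w) with hq
    have hqmonic : q.Monic := (hpmonic j).map _
    have hqdeg : q.natDegree = (p j).natDegree := (hpmonic j).natDegree_map _
    have hevm : P.eval ⊤ trivial (g (m j)) = MvPolynomial.eval w (m j) := by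
      have := RingHom.congr_fun (evalRingHom_comp_eval₂Hom S d x P) (m j)
      rw [RingHom.comp_apply, AlgPoints.evalRingHom_apply] at this
      exact this
    have hroot : q.IsRoot (MvPolynomial.eval w (m j) * P.eval ⊤ trivial (h j)) := by
      have h1 := congrArg (P.evalRingHom ⊤ trivial) (hproot j)
      rw [Polynomial.hom_eval₂, map_zero, map_mul, AlgPoints.evalRingHom_apply, AlgPoints.evalRingHom_apply, hevm] at h1
      rw [Polynomial.IsRoot, hq, Polynomial.eval_map]
      rw [hg, evalRingHom_comp_eval₂Hom] at h1
      exact h1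
    have hlt := hroot.norm_lt_cauchyBound hqmonic.ne_zero
    -- the Cauchy bound of a monic polynomial is at most `1 + ∑ |coeff|`
    have hcb : (q.cauchyBound : ℝ) ≤ 1 + Bcoef j := by
      have hsup : ((Finset.range q.natDegree).sup fun i ↦ ‖q.coeff i‖₊) ≤
          ∑ i ∈ Finset.range (p j).natDegree, ‖q.coeff i‖₊ :=
        Finset.sup_le fun i hi ↦ Finset.single_le_sum (f := fun i ↦ ‖q.coeff i‖₊) (fun _ _ ↦ zero_le) (by rwa [← hqdeg])
      have hsup' : (((Finset.range q.natDegree).sup fun i ↦ ‖q.coeff i‖₊ : NNReal) : ℝ) ≤ Bcoef j := by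
        refine (NNReal.coe_le_coe.2 hsup).trans ?_
        rw [NNReal.coe_sum]
        refine le_trans (le_of_eq (Finset.sum_congr rfl fun i _ ↦ ?_)) (hBcoef j w hP)
        rw [coe_nnnorm, hq, Polynomial.coeff_map]
      rw [Polynomial.cauchyBound, hqmonic.leadingCoeff, nnnorm_one, div_one, NNReal.coe_add, NNReal.coe_one]
      linarith
    have hy : ‖MvPolynomial.eval w (m j) * P.eval ⊤ trivial (h j)‖ ≤ 1 + Bcoef j :=
      ((NNReal.coe_lt_coe.2 hlt).le.trans hcb)
    have hmw : MvPolynomial.eval w (m j) ≠ 0 := hmK j w hP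
    calc ‖P.eval ⊤ trivial (h j)‖ = ‖(MvPolynomial.eval w (m j))⁻¹ * (MvPolynomial.eval w (m j) * P.eval ⊤ trivial (h j))‖ := by
          rw [← mul_assoc, inv_mul_cancel₀ hmw, one_mul]
      _ ≤ Binv j * (1 + Bcoef j) := by
          rw [norm_mul]
          exact mul_le_mul (hBinv j w hP) hy (norm_nonneg _) ((norm_nonneg _).trans (hBinv j w hP))
  -- `x(ℂ)⁻¹(K)` is closed and contained in a compact sublevel set of the coordinates
  set R : ℝ := ∑ j, |Binv j * (1 + Bcoef j)| with hR
  have hR0 : 0 ≤ R := Finset.sum_nonneg fun _ _ ↦ abs_nonneg _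
  have hsub : coordMap S x ⁻¹' K ⊆ coordMap S h ⁻¹' Metric.closedBall 0 R := by
    intro P hP
    rw [mem_preimage, Metric.mem_closedBall, dist_zero_right, pi_norm_le_iff_of_nonneg hR0]
    intro j
    rw [coordMap_apply]
    refine (hbound P hP j).trans ((le_abs_self _).trans ?_)
    exact Finset.single_le_sum (fun j _ ↦ abs_nonneg (Binv j * (1 + Bcoef j))) (Finset.mem_univ j)
  exact (isCompact_preimage_coordMap S h hh (isCompact_closedBall 0 R)).of_isClosed_subset
    (hKc.isClosed.preimage (continuous_coordMap S x)) hsub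

end EtaleCoordinates

end Literature.AlgebraicGeometry.FundamentalGroup
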